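import Mathlib
import Summits.ValiantsHypothesis.ValiantsHypothesis.Theorems.BarrierLeverPartitionMinorsHitByVPHiddenStatesDiagCoreOne

/-!
# Route BarrierLever — item `PartitionMinorsHitByVP` (stmt-ValiantsHypothesis-19717), line `hidden-states`:
# BALL-DIAGONAL I — the σ-TABLE and its entry formula (first brick of the formalisation of PROOF-balldiagonal-p6g12)

Helper file (`--supports stmt-ValiantsHypothesis-19717`; cell valiant-natproofs, rung V4, 𝒟-side door (c), registered line
`Cruxes/PartitionMinorsHitByVP/Lines/hidden_states.lean` v7; prover seat val-np-p6 gen 12). Definition-free; closes NO item.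

THE σ-TABLE (memo val-np-p6 g12 §7, HOME/val-np-p6/g12/PROOF-balldiagonal-p6g12.md): states = coordinates `Fin h`; a set `C` of CORE states, and for
each core state `c` a FACE `F c ⊆ Fin h` disjoint from `C`; base point `0`; `t_q = e_q` for `q ∉ C`, `t_c = e_c − 1_{F c}` for `c ∈ C` (entries in
`{0, ±1}`). `exists_sigmaTable`: the hidden point of a column `J` has coordinate `[a ∈ J]` at `a ∈ C` and `[a ∈ J] − #{c ∈ J ∩ C : a ∈ F c}` at `a ∉ C`,
so the entry against a row `S` is `[S ∩ C ⊆ J] · ∏_{a ∈ S ∖ C} ([a ∈ J] − #{c ∈ J ∩ C : a ∈ F c})` — the block structure over `2^C` of PROOF §1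
(`[D ⊆ D′] · Z_{Λ(D′)}[T, I]`). The paper theorem (exhaustively verified for every down-set of co-size `h+1`, `h ≤ 9`, kit j307595): with `F` a
bijection onto the missing complex, the ball `B_{h−2}` on `h` states serves every down-set of co-size `h + 1` — all diagonal cells, hence (p629886) the
linear top window. This file is only the table.

WHAT THIS IS NOT: a table and its entries; the elimination (PROOF §2) and the face-poset determinant (§3) are for the successor; nothing on 14610 / VP ≠ VNP.
-/

set_option linter.dupNamespace false

namespace Summit.ValiantsHypothesis.ValiantsHypothesis.Theorems.BarrierLever.HiddenStates

open Finset

noncomputable section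

namespace Tilt

/-- **THE σ-TABLE AND ITS ENTRY FORMULA.** See the module docstring. -/
theorem exists_sigmaTable (h m : ℕ) (p₀ : Fin m) (C : Finset (Fin h)) (F : Fin h → Finset (Fin h))
    (hF : ∀ c a, a ∈ F c → a ∉ C) :
    ∃ tx : Fin m → Option (Fin h) → Fin h → ℂ, ∀ (J S : Finset (Fin h)),
      ∏ a ∈ S, (tx p₀ none a + ∑ q ∈ J, tx p₀ (some q) a)
        = (if S ∩ C ⊆ J then 1 else 0) *
          ∏ a ∈ S \ C, ((if a ∈ J then (1 : ℂ) else 0) - (((J ∩ C).filter fun c => a ∈ F c).card : ℂ)) := by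
  classical
  let tx : Fin m → Option (Fin h) → Fin h → ℂ := fun _ o a =>
    match o with
    | none => 0
    | some q => (if a = q then 1 else 0) - (if q ∈ C ∧ a ∈ F q then 1 else 0)
  refine ⟨tx, fun J S => ?_⟩
  -- the hidden point
  have hpt : ∀ a, tx p₀ none a + ∑ q ∈ J, tx p₀ (some q) a
      = (if a ∈ J then (1 : ℂ) else 0) - (((J ∩ C).filter fun c => a ∈ F c).card : ℂ) := by
    intro a
    have h0 : tx p₀ none a = 0 := rfl
    have h1 : ∀ q ∈ J, tx p₀ (some q) a = (if q = a then (1 : ℂ) else 0) - (if q ∈ C ∧ a ∈ F q then 1 else 0) := by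
      intro q _
      simp only [tx, @eq_comm _ a q]
    rw [h0, zero_add, Finset.sum_congr rfl h1, Finset.sum_sub_distrib, Finset.sum_ite_eq' J a (fun _ => (1 : ℂ))]
    congr 1
    rw [← Finset.sum_filter, Finset.sum_const, nsmul_eq_mul, mul_one]
    congr 2
    ext c
    simp only [Finset.mem_filter, Finset.mem_inter]
    tauto
  simp_rw [hpt]
  -- split the product over `S ∩ C` and `S \ C`
  rw [← Finset.prod_sdiff (Finset.inter_subset_left (s₁ := S) (s₂ := C))]
  have hsd : S \ (S ∩ C) = S \ C := by
    ext a; simp only [Finset.mem_sdiff, Finset.mem_inter]; tauto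
  rw [hsd, mul_comm]
  congr 1
  -- on `S ∩ C` the count vanishes and the factor is `[a ∈ J]`
  have hC : ∀ a ∈ S ∩ C, ((if a ∈ J then (1 : ℂ) else 0) - (((J ∩ C).filter fun c => a ∈ F c).card : ℂ))
      = if a ∈ J then 1 else 0 := by
    intro a ha
    have haC : a ∈ C := (Finset.mem_inter.mp ha).2
    have : (J ∩ C).filter (fun c => a ∈ F c) = ∅ := by
      ext c
      simp only [Finset.mem_filter, Finset.notMem_empty, iff_false, not_and]
      intro _ haF
      exact hF c a haF haC
    rw [this, Finset.card_empty, Nat.cast_zero, sub_zero]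
  rw [Finset.prod_congr rfl hC, Finset.prod_boole]
  by_cases hsub : S ∩ C ⊆ J
  · rw [if_pos hsub, if_pos (fun a ha => hsub ha)]
  · rw [if_neg hsub, if_neg (fun h' => hsub (fun a ha => h' a ha))]

end Tilt

end

end Summit.ValiantsHypothesis.ValiantsHypothesis.Theorems.BarrierLever.HiddenStates
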